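import Mathlib
import Literature.MathematicalPhysics.StatisticalMechanics.Crystallization
import Literature.MathematicalPhysics.StatisticalMechanics.LennardJonesClusters
import Summits.AtomisticToContinuum.Crystallization.Theses.ThreeConeCertificate
import Summits.AtomisticToContinuum.Crystallization.Theorems.ThreeConeCertificateExactCertificateTransfer1D
import Summits.AtomisticToContinuum.Crystallization.Theorems.ThreeConeCertificateExactCertificateTransfer1DClassCrossing
import Summits.AtomisticToContinuum.Crystallization.Theorems.ThreeConeCertificateExactCertificateTransfer1DClassPsiPosType
import Summits.AtomisticToContinuum.Crystallization.Theorems.ThreeConeCertificateExactCertificateTransfer1DClassPosType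
import Summits.AtomisticToContinuum.Crystallization.Theorems.ThreeConeCertificateExactCertificateTransfer1DClassCore
import Summits.AtomisticToContinuum.Crystallization.Theorems.ThreeConeCertificateExactCertificateTransfer1DClassTail
import Summits.AtomisticToContinuum.Crystallization.Theorems.ThreeConeCertificateExactCertificateTransfer1DClassChain
import Summits.AtomisticToContinuum.Crystallization.Theorems.ThreeConeCertificateExactCertificateTransfer1DClassBounds
import Summits.AtomisticToContinuum.Crystallization.Theorems.ThreeConeCertificateExactCertificateTransfer1DGroundStateUnique
import Summits.AtomisticToContinuum.Crystallization.Theorems.ThreeConeCertificateExactCertificateTransfer1DClass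

/-!
# Crux `ExactCertificate` (stmt-AtomisticToContinuum-11959), line `closure-makes-nogap-exact`, lead c9:
# TRANSFER skeleton V — the d = 1 exactness mechanism as a CLASS THEOREM (`OneCrossingChainCertificate`)

Skeleton V v2 (c9, 2026-08-17) — SORRY-FREE: all eight registered stubs LANDED in wave 1 (stub_classCrossing p154270, stub_classPsiPosType p154457, stub_classPosType p154578, stub_classCore p154879, stub_classTail p154624, stub_classChain p154687, stub_groundStateUnique p154816; lead: stub_classBounds p155013) and are IMPORTED below; the assembly `…Transfer1DClass.lean` (registered `stub_classAssembly`) and the Mie instances `…Transfer1DClassMie.lean` (`stub_mieChain`) are separate tree files.  v1:  The 3-D line is parked where c5–c8 left it (skeleton v6 of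
`Lines/closure_makes_nogap_exact.lean`: stubs `stub_noGap` = SharpSplit, `stub_periodicMinimum` = KeplerBound =
item 11961 ↔ 0627, both item-level; nothing below is a stub of the 3-D crux).  This file continues the Transfer lane of
c6 (`exactCertificate1D`), c7 (`crystallization_lennardJones_one`) and c8 (`slackRigidity_lennardJones_one`) with the
one question the lane left open — WHAT EXACTLY is the d = 1 exactness mechanism? — answered as a class theorem:

  `OneCrossingChainCertificate` := for EVERY pair potential `V(r) = −∫₀^∞ e^{−tr} p(t) dt` whose Laplace density `p`
  is measurable, `≥ 0` on `(0, t₀]` and `≤ 0` on `[t₀, ∞)` (ONE sign change: long-range attraction, short-range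
  repulsion) with a polynomial envelope `|p(t)| ≤ C (t² + t^M)` (`M ≥ 2`; so `V = O(r⁻³)` is chain-summable), and for
  EVERY spacing `a > 0` at zero pressure (`Σ_k (k+1) ∫₀^∞ e^{−t(k+1)a} p(t) t dt = 0`, i.e. `Σ_{m≥1} m V′(ma) = 0`),
  the crux `ExactCertificate` holds VERBATIM with `3 ↦ 1` and `lennardJones ↦ V`.

Witness: `P = aℤ`, `ρ = a`, `c = 0`, `U ≡ 0`, `f = F_a := −¼Δ_aΨ_a`, `Ψ_a(x) = −4Σ_{k≥0}(k+1)V(|x|+(k+1)a)`,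
`g = (V − F_a)·1_{(0,a)}` — c6's construction with the explicit Lennard-Jones density `t⁵/6! − t¹¹/12!` replaced by
the hypotheses above; every stub below is the class form of one of c6's seven landed stub files (workers adapt those
proofs).  Corollaries (lead's assembly file): the sharp Kepler bound `E_N(x) ≥ N·Σ_{m≥1}V(ma)` on the line,
`HasPeriodicGroundStateEnergy V 1`, uniqueness of the zero-pressure spacing, and the instances `mieWith A B p q`
(`A, B > 0`, `p > q ≥ 3`), `lennardJones = mieWith (1/12) (1/6) 12 6`.  One independent rigidity stub rides along
(`stub_groundStateUnique`: finite Lennard-Jones chain ground states are unique up to an isometry of the line and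
centro-symmetric).
-/

noncomputable section

/-! ## The stubs — ALL LANDED (imported; namespace `…Theorems.ThreeConeCertificateExactCertificate.Transfer1D`):
`stub_classCrossing` (A, p154270), `stub_classPsiPosType` (B, p154457), `stub_classPosType` (C, p154578), `stub_classCore`
(D, p154879), `stub_classTail` (E, p154624), `stub_classChain` (F, p154687), `stub_groundStateUnique` (G, p154816),
`stub_classBounds` (H, lead, p155013). -/

namespace Summit.AtomisticToContinuum.Crystallization.Cruxes.ExactCertificate.Transfer1D

open Literature.MathematicalPhysics.StatisticalMechanics MeasureTheory Set Filter Topology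
open scoped BigOperators
open Summit.AtomisticToContinuum.Crystallization.Theorems.ThreeConeCertificateExactCertificate.Transfer1D

/-- **The deciding statement of Transfer skeleton V: `ExactCertificate` with `3 ↦ 1` and `lennardJones ↦ V`, for EVERY
pair potential `V` of the one-crossing Laplace class at EVERY zero-pressure spacing.**  Hypotheses, in order: `p`
measurable; `0 < t₀`; `p ≥ 0` on `(0,t₀]`; `p ≤ 0` on `[t₀,∞)`; `2 ≤ M`; envelope `|p(t)| ≤ C(t²+t^M)` on `(0,∞)`; Laplace
representation `V(r) = −∫₀^∞e^{−tr}p(t)dt` on `(0,∞)`; `0 < a`; zero pressure `Σ_k(k+1)∫₀^∞e^{−t(k+1)a}p(t)t dt = 0`.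
Conclusion: the body of the route decl `ThreeConeCertificate.ExactCertificate` with `3 ↦ 1`, `lennardJones ↦ V`. -/
def OneCrossingChainCertificate : Prop :=
  ∀ (V p : ℝ → ℝ) (t₀ C a : ℝ) (M : ℕ), Measurable p → 0 < t₀ →
    (∀ t : ℝ, 0 < t → t ≤ t₀ → 0 ≤ p t) → (∀ t : ℝ, t₀ ≤ t → p t ≤ 0) → 2 ≤ M →
    (∀ t : ℝ, 0 < t → |p t| ≤ C * (t ^ 2 + t ^ M)) →
    (∀ r : ℝ, 0 < r → V r = -(∫ t in Set.Ioi (0 : ℝ), Real.exp (-(t * r)) * p t)) →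
    0 < a →
    HasSum (fun k : ℕ => ((k : ℝ) + 1) *
      ∫ t in Set.Ioi (0 : ℝ), Real.exp (-(t * (((k : ℝ) + 1) * a))) * p t * t) 0 →
    ∃ (P : PeriodicConfiguration 1) (ρ c : ℝ) (g U f : ℝ → ℝ),
      (∀ r : ℝ, 0 < r → V r = g r + U r + f r) ∧ (∀ r : ℝ, 0 < r → 0 ≤ U r) ∧
      (∀ r : ℝ, ρ ≤ r → g r = 0) ∧
      (∀ (n : ℕ) (y : Fin n → EuclideanSpace ℝ (Fin 1)) (w : Fin n → ℝ),
        0 ≤ ∑ i, ∑ j, w i * w j * f (dist (y i) (y j))) ∧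
      (∀ (N : ℕ) (x : Fin N → EuclideanSpace ℝ (Fin 1)), Function.Injective x →
        -(c * (N : ℝ)) ≤ interactionEnergy g x) ∧
      c + f 0 / 2 = -(P.energyPerParticle V)

/-! ## Composition: the stubs close `OneCrossingChainCertificate` -/

/-- **THE CLASS CERTIFICATE** (`ExactCertificate` with `3 ↦ 1`, `lennardJones ↦ V`): composition of the registered stubs,
exactly along c6's `exactCertificate1D`. -/
theorem OneCrossingChainCertificate_of : OneCrossingChainCertificate := by
  intro V p t₀ C a M hpm ht₀ hpos hneg hM hbd hV ha hz
  obtain ⟨hint0, hint1, hsum1, hsum0⟩ := stub_classBounds V p C M hM hpm hbd hV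
  -- the single-crossing conclusion at `a`
  have hCR := stub_classCrossing p t₀ ht₀ hpos hneg a ha (fun k => hint1 _ (by positivity)) hz
  -- the chain `aℤ` and the telescoping identities
  have hs0 : Summable (fun k : ℕ => V (((k : ℝ) + 1) * a)) := by
    simpa only [zero_add] using hsum0 a ha 0 le_rfl
  obtain ⟨P, e, -, hP⟩ := stub_classChain V a ha hs0
  obtain ⟨htail, hF0⟩ := stub_classTail V a ha (hsum1 a ha) (hsum0 a ha)
  -- the tail interpolant `F_a`
  set Fa : ℝ → ℝ := fun x => ∑' k : ℕ, ((k : ℝ) + 1) * (V (|x + a| + ((k : ℝ) + 1) * a)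
      - 2 * V (|x| + ((k : ℝ) + 1) * a) + V (|x - a| + ((k : ℝ) + 1) * a)) with hFa
  have hFa_tail : ∀ x : ℝ, a ≤ x → Fa x = V x := fun x hx => htail x hx
  have hFa_zero : Fa 0 = -2 * ∑' k : ℕ, V (((k : ℝ) + 1) * a) := by
    rw [← hF0, hFa]
    simp only [zero_add, zero_sub, abs_neg, abs_zero, abs_of_pos ha]
  have hcore : ∀ r : ℝ, 0 < r → r < a → Fa r ≤ V r :=
    fun r hr hra => stub_classCore V p a ha hint0 hV (hsum1 a ha) hCR r hr hra
  have hposT : ∀ (n : ℕ) (y : Fin n → EuclideanSpace ℝ (Fin 1)) (w : Fin n → ℝ),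
      0 ≤ ∑ i, ∑ j, w i * w j * Fa (dist (y i) (y j)) :=
    stub_classPosType V a ha (hsum1 a ha)
      (stub_classPsiPosType stub_quadAntitone V p a ha hint0 hV (hsum1 a ha) hCR)
  refine ⟨P, a, 0, fun r => if r < a then V r - Fa r else 0, fun _ => 0, Fa, ?_, fun _ _ => le_rfl, ?_, hposT, ?_, ?_⟩
  · -- (S1) the split on (0,∞)
    intro r _
    show V r = (if r < a then V r - Fa r else 0) + 0 + Fa r
    by_cases h : r < a
    · rw [if_pos h]; ring
    · rw [if_neg h, hFa_tail r (not_lt.1 h)]; ring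
  · -- (S3) finite range `ρ = a`
    intro r hr
    show (if r < a then V r - Fa r else 0) = 0
    rw [if_neg (not_lt.2 hr)]
  · -- (S5) `0`-stability: `g ≥ 0` pair by pair
    intro N x hx
    rw [zero_mul, neg_zero]
    unfold interactionEnergy
    refine Finset.sum_nonneg fun i _ => Finset.sum_nonneg fun j hj => ?_
    have hd : 0 < dist (x i) (x j) := dist_pos.2 fun heq => (Finset.mem_Ioi.1 hj).ne' (hx heq.symm)
    show 0 ≤ (if dist (x i) (x j) < a then V (dist (x i) (x j)) - Fa (dist (x i) (x j)) else 0)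
    by_cases h : dist (x i) (x j) < a
    · rw [if_pos h]
      exact sub_nonneg.2 (hcore _ hd h)
    · rw [if_neg h]
  · -- (S6) the value: `0 + F_a(0)/2 = −e(aℤ)`
    rw [hP, hFa_zero]
    ring

end Summit.AtomisticToContinuum.Crystallization.Cruxes.ExactCertificate.Transfer1D

end
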